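import Summits.HodgeConjecture.CorCM.Census.TwistScrewModel
import Summits.HodgeConjecture.CorCM.Census.TwistGenerationCover

/-!
# Uniform twist generation, XI: THE UPPER-CLASS CALCULUS — base-change stability, uniqueness, flip closure; tied types and their flips

COR-CM (cell `pub-hodgecm2`), count-neutral kernel combinatorics by the binder seat b09 (gen 37; lane UNIFORM TWIST GENERATION, part XI), on
parts II–IV and X (`cst`, `ddist`, `pot`, `nearCl`, the near-class calculus; `upCl`) used BY NAME.  Theorems only: no definition, no `decide`,
no certificate, no named fact, no `sorry`.
HONEST FRAMING: `HC_CM` is NOT proved, here or anywhere in the tree; nothing here is a period or a headline.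

Along a datum `θ : G ≃ ℤ/2n × B` (`θ (PQ) = θ P + θ Q`, `θ c = (n, 0)`), for the upper class `upCl a` of part X (nearest centres = the arc
`{a, …, a − ℓ + 1}`, `1 ≤ ℓ ≤ n`):
* §1 `up_rt` (base change shifts the index by `−(θQ).1`), `up_unique` (the index is unique — two arcs of length `≤ n` with a common point
  cannot have different upper ends modulo `2n`), `up_oflipCM` (**flip closure**: flipping at a deviation place `t ∈ cst a ∖ Ψ`, `θ t = (x, ·)`,
  keeps the upper end `a` and shortens the arc to length `min ℓ (n − (x − a).val)`), `up_oflipCM_oflipCM`, and `near_subset_up`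
  (`nearCl a ⊆ upCl a`, `n ≥ 2`);
* §2 **tied types** (`∀ a', ddist (cst a') Ψ = pot Ψ`, e.g. the screw type of part XIV): they lie in no upper class (`not_up_of_tied`), but
  a single flip at `t ∉ Ψ`, `θ t = (x, ·)`, lies in `upCl x` with `ℓ = n` (`up_oflipCM_of_tied`), and base changes of tied types are tied;
* §3 the choice at a block representative toward the upper centre (`exists_choice_up`, part IV's `exists_choice` with `upCl` for `nearCl`).

## References
* [Pohlmann1968] H. Pohlmann, Algebraic cycles on abelian varieties of complex multiplication type, Ann. of Math. 88 (1968), Thm 1.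
* [Milne1999] J. S. Milne, Lefschetz motives and the Tate conjecture, Compositio Math. 117 (1999), Prop. 2.1, p. 54.
-/

namespace Summit.HodgeConjecture.CorCM.Census.TwistGeneration

open Finset
open Summit.HodgeConjecture.CorCM.Prior.AllgGroup.RfwfAllgGroup
open Summit.HodgeConjecture.CorCM.Census.BlockParity
open Summit.HodgeConjecture.CorCM.Census.Coinvariant

noncomputable section

variable {G : Type*} [Group G] [Fintype G] [DecidableEq G] {c : G}
variable {B : Type} [AddGroup B]
variable {n : ℕ} [NeZero n] (θ : G ≃ ZMod (2 * n) × B)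
variable (hθ : ∀ P Q : G, θ (P * Q) = θ P + θ Q) (hθc : θ c = (((n : ℕ) : ZMod (2 * n)), 0))

/-! ## §1 The upper-class calculus -/

section UpCalc

omit [NeZero n] in
/-- `val` of a sum of two small elements of `ℤ/2n`. [folklore] -/
theorem val_add_of_lt_n {u v : ZMod (2 * n)} (hu : u.val < n) (hv : v.val < n) : (u + v).val = u.val + v.val :=
  ZMod.val_add_of_lt (by omega)

/-- Distances from a base change: `ddist (cst a') (Ψ·Q⁻¹) = ddist (cst (a' + (θQ).1)) Ψ`. [folklore] -/
theorem ddist_cst_rt (Q : G) (Ψ : CMF G c) (a' : ZMod (2 * n)) :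
    ddist (cst θ hθ hθc a') (rt c Q Ψ) = ddist (cst θ hθ hθc (a' + (θ Q).1)) Ψ := by
  rw [show cst θ hθ hθc a' = rt c Q (cst θ hθ hθc (a' + (θ Q).1)) by rw [rt_cst, add_sub_cancel_right], ddist_rt]

/-- **The upper class is base-change stable**: `Ψ ∈ upCl a → Ψ·Q⁻¹ ∈ upCl (a − (θQ).1)`. [folklore] -/
theorem up_rt {a : ZMod (2 * n)} {Ψ : CMF G c} (h : Ψ ∈ upCl θ hθ hθc a) (Q : G) : rt c Q Ψ ∈ upCl θ hθ hθc (a - (θ Q).1) := by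
  obtain ⟨ℓ, h1, h2, h3⟩ := h
  refine ⟨ℓ, h1, h2, fun a' => ?_⟩
  rw [ddist_cst_rt θ hθ hθc, pot_rt, h3, show a - (a' + (θ Q).1) = a - (θ Q).1 - a' by abel]

/-- **The upper index is unique.** [folklore] -/
theorem up_unique {a a' : ZMod (2 * n)} {Ψ : CMF G c} (h : Ψ ∈ upCl θ hθ hθc a) (h' : Ψ ∈ upCl θ hθ hθc a') : a = a' := by
  obtain ⟨ℓ, h1, h2, h3⟩ := h
  obtain ⟨ℓ', h1', h2', h3'⟩ := h'
  have ha : ddist (cst θ hθ hθc a) Ψ = pot θ hθ hθc Ψ := (h3 a).mpr (by rw [sub_self, ZMod.val_zero]; omega)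
  have ha' : ddist (cst θ hθ hθc a') Ψ = pot θ hθ hθc Ψ := (h3' a').mpr (by rw [sub_self, ZMod.val_zero]; omega)
  have h4 : (a - a').val < ℓ := (h3 a').mp ha'
  have h5 : (a' - a).val < ℓ' := (h3' a).mp ha
  by_contra hne
  have hv : a - a' ≠ 0 := fun h0 => hne (sub_eq_zero.mp h0)
  have h6 : (a' - a).val = 2 * n - (a - a').val := by
    rw [show a' - a = -(a - a') by ring, ZMod.neg_val, if_neg hv]
  have := ZMod.val_lt (a - a')
  omega

/-- **Flip closure of the upper class**: flipping `Ψ ∈ upCl a` at a deviation place of `cst a ∖ Ψ` stays in `upCl a`. [folklore] -/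
theorem up_oflipCM (hc2 : c * c = 1) {a : ZMod (2 * n)} {Ψ : CMF G c} (h : Ψ ∈ upCl θ hθ hθc a) {t : G}
    (ht : t ∈ (cst θ hθ hθc a).1 \ Ψ.1) : oflipCM c hc2 t Ψ ∈ upCl θ hθ hθc a := by
  have hpot := pot_eq_of_up θ hθ hθc h
  obtain ⟨ℓ, h1, h2, h3⟩ := h
  have htΨ : t ∉ Ψ.1 := (mem_sdiff.mp ht).2
  set x : ZMod (2 * n) := (θ t).1 with hx
  have hm : (x - a).val < n := (mem_cst θ hθ hθc a t).mp (mem_sdiff.mp ht).1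
  set P : ℕ := pot θ hθ hθc Ψ with hP
  -- the flip laws at every centre
  have hin : ∀ a' : ZMod (2 * n), (x - a').val < n → ddist (cst θ hθ hθc a') (oflipCM c hc2 t Ψ) + 1 = ddist (cst θ hθ hθc a') Ψ :=
    fun a' ha' => ddist_oflipCM_of_mem_sdiff hc2 (mem_sdiff.mpr ⟨(mem_cst θ hθ hθc a' t).mpr ha', htΨ⟩)
  have hout : ∀ a' : ZMod (2 * n), ¬ (x - a').val < n → ddist (cst θ hθ hθc a') (oflipCM c hc2 t Ψ) = ddist (cst θ hθ hθc a') Ψ + 1 :=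
    fun a' ha' => ddist_oflipCM_of_not_mem hc2 htΨ (fun h' => ha' ((mem_cst θ hθ hθc a' t).mp h'))
  -- the new potential is `P − 1`
  have hda : ddist (cst θ hθ hθc a) (oflipCM c hc2 t Ψ) + 1 = P := by rw [hin a hm, ← hpot]
  have hpot' : pot θ hθ hθc (oflipCM c hc2 t Ψ) = P - 1 := by
    apply le_antisymm
    · have := pot_le θ hθ hθc (oflipCM c hc2 t Ψ) a; omega
    · obtain ⟨a', ha'⟩ := exists_pot_eq θ hθ hθc (oflipCM c hc2 t Ψ)
      have h6 := ddist_le_ddist_oflipCM_add_one hc2 (cst θ hθ hθc a') Ψ t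
      have h7 := pot_le θ hθ hθc Ψ a'
      omega
  refine ⟨min ℓ (n - (x - a).val), by omega, by omega, fun a' => ?_⟩
  rw [hpot']
  constructor
  · intro hd
    -- `t ∈ cst a'` (else the distance went up), and `a'` was nearest before
    have hxa' : (x - a').val < n := by
      by_contra hh
      have := hout a' hh
      have := pot_le θ hθ hθc Ψ a'
      omega
    have hd0 : ddist (cst θ hθ hθc a') Ψ = P := by have := hin a' hxa'; omega
    have hi : (a - a').val < ℓ := (h3 a').mp hd0
    have hval : (x - a').val = (x - a).val + (a - a').val := by
      rw [show x - a' = (x - a) + (a - a') by abel, val_add_of_lt_n hm (by omega)]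
    rw [lt_min_iff]
    exact ⟨hi, by omega⟩
  · intro hi
    rw [lt_min_iff] at hi
    have hd0 : ddist (cst θ hθ hθc a') Ψ = P := (h3 a').mpr hi.1
    have hval : (x - a').val = (x - a).val + (a - a').val := by
      rw [show x - a' = (x - a) + (a - a') by abel, val_add_of_lt_n hm (by omega)]
    have := hin a' (by omega)
    omega

/-- Two successive deviation flips stay in the upper class. [folklore] -/
theorem up_oflipCM_oflipCM (hc2 : c * c = 1) {a : ZMod (2 * n)} {Ψ : CMF G c} (h : Ψ ∈ upCl θ hθ hθc a) {s s' : G}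
    (hs : s ∈ (cst θ hθ hθc a).1 \ Ψ.1) (hs' : s' ∈ (cst θ hθ hθc a).1 \ Ψ.1) (hss' : s ≠ s') :
    oflipCM c hc2 s (oflipCM c hc2 s' Ψ) ∈ upCl θ hθ hθc a := by
  refine up_oflipCM θ hθ hθc hc2 (up_oflipCM θ hθ hθc hc2 h hs') ?_
  rw [dev_oflip c hc2 (mem_sdiff.mp hs').1 (mem_sdiff.mp hs').2]
  exact mem_erase.mpr ⟨hss', hs⟩

/-- **The near class lies in the upper class** (`n ≥ 2`): `ℓ = 2` at an adjacent tie, `ℓ = 1` at a unique nearest centre. [folklore] -/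
theorem near_subset_up (hn : 2 ≤ n) {a : ZMod (2 * n)} {Ψ : CMF G c} (h : Ψ ∈ nearCl θ hθ hθc a) : Ψ ∈ upCl θ hθ hθc a := by
  have hpot := pot_eq_of_near θ hθ hθc h
  rw [mem_nearCl_iff] at h
  have h1val : (1 : ZMod (2 * n)).val = 1 := by
    rw [show (1 : ZMod (2 * n)) = ((1 : ℕ) : ZMod (2 * n)) by norm_cast, ZMod.val_cast_of_lt (by omega)]
  -- `(a − a').val < 2 ↔ a' ∈ {a, a − 1}`; `(a − a').val < 1 ↔ a' = a`
  have key0 : ∀ a' : ZMod (2 * n), (a - a').val = 0 ↔ a' = a := fun a' => by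
    rw [ZMod.val_eq_zero, sub_eq_zero]; exact eq_comm
  have key1 : ∀ a' : ZMod (2 * n), (a - a').val = 1 ↔ a' = a - 1 := fun a' => by
    constructor
    · intro hv
      have : a - a' = 1 := ZMod.val_injective _ (by rw [hv, h1val])
      linear_combination -this
    · rintro rfl; rw [sub_sub_cancel, h1val]
  by_cases htie : ddist (cst θ hθ hθc (a - 1)) Ψ = ddist (cst θ hθ hθc a) Ψ
  · refine ⟨2, by omega, hn, fun a' => ?_⟩
    rw [hpot]
    constructor
    · intro hd
      by_contra hv
      have hne : a' ≠ a := fun e => by rw [e, sub_self, ZMod.val_zero] at hv; omega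
      have hne' : a' ≠ a - 1 := fun e => by rw [(key1 a').mpr e] at hv; omega
      exact absurd hd (ne_of_gt ((h a').2 hne hne'))
    · intro hv
      rcases Nat.lt_succ_iff_lt_or_eq.mp hv with hv | hv
      · rw [(key0 a').mp (by omega)]
      · rw [(key1 a').mp hv, htie]
  · refine ⟨1, le_rfl, by omega, fun a' => ?_⟩
    rw [hpot, Nat.lt_one_iff, key0]
    constructor
    · intro hd
      by_contra hne
      by_cases hne' : a' = a - 1
      · exact htie (hne' ▸ hd)
      · exact absurd hd (ne_of_gt ((h a').2 hne hne'))
    · rintro rfl; rfl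

end UpCalc

/-! ## §2 Tied types and their single flips -/

section Tied

/-- **A tied type lies in no upper class** (its arc of nearest centres would be all of `ℤ/2n`). [folklore] -/
theorem not_up_of_tied {Ψ : CMF G c} (hΨ : ∀ a' : ZMod (2 * n), ddist (cst θ hθ hθc a') Ψ = pot θ hθ hθc Ψ) (a : ZMod (2 * n)) :
    Ψ ∉ upCl θ hθ hθc a := by
  rintro ⟨ℓ, -, h2, h3⟩
  have h := (h3 (a - n)).mp (hΨ _)
  rw [sub_sub_cancel, val_n] at h
  omega

/-- **Base changes of tied types are tied.** [folklore] -/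
theorem tied_rt {Ψ : CMF G c} (hΨ : ∀ a' : ZMod (2 * n), ddist (cst θ hθ hθc a') Ψ = pot θ hθ hθc Ψ) (Q : G) :
    ∀ a' : ZMod (2 * n), ddist (cst θ hθ hθc a') (rt c Q Ψ) = pot θ hθ hθc (rt c Q Ψ) := fun a' => by
  rw [ddist_cst_rt θ hθ hθc, pot_rt, hΨ]

/-- **A single flip of a tied type lies in the upper class of its row**: for `t ∉ Ψ` with `θ t = (x, ·)`, `Ψ^{(t)} ∈ upCl x` with `ℓ = n`
(the centres whose arc contains `x` get nearer by one, all others farther by one). [folklore] -/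
theorem up_oflipCM_of_tied (hc2 : c * c = 1) {Ψ : CMF G c} (hΨ : ∀ a' : ZMod (2 * n), ddist (cst θ hθ hθc a') Ψ = pot θ hθ hθc Ψ)
    {t : G} (ht : t ∉ Ψ.1) : oflipCM c hc2 t Ψ ∈ upCl θ hθ hθc (θ t).1 := by
  set x : ZMod (2 * n) := (θ t).1 with hx
  set P : ℕ := pot θ hθ hθc Ψ with hP
  have hin : ∀ a' : ZMod (2 * n), (x - a').val < n → ddist (cst θ hθ hθc a') (oflipCM c hc2 t Ψ) + 1 = P :=
    fun a' ha' => by rw [ddist_oflipCM_of_mem_sdiff hc2 (mem_sdiff.mpr ⟨(mem_cst θ hθ hθc a' t).mpr ha', ht⟩), hΨ]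
  have hout : ∀ a' : ZMod (2 * n), ¬ (x - a').val < n → ddist (cst θ hθ hθc a') (oflipCM c hc2 t Ψ) = P + 1 :=
    fun a' ha' => by rw [ddist_oflipCM_of_not_mem hc2 ht (fun h' => ha' ((mem_cst θ hθ hθc a' t).mp h')), hΨ]
  have hxx : (x - x).val < n := by rw [sub_self, ZMod.val_zero]; exact Nat.pos_of_ne_zero (NeZero.ne n)
  have hpot' : pot θ hθ hθc (oflipCM c hc2 t Ψ) = P - 1 := by
    apply le_antisymm
    · have := pot_le θ hθ hθc (oflipCM c hc2 t Ψ) x; have := hin x hxx; omega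
    · obtain ⟨a', ha'⟩ := exists_pot_eq θ hθ hθc (oflipCM c hc2 t Ψ)
      have h6 := ddist_le_ddist_oflipCM_add_one hc2 (cst θ hθ hθc a') Ψ t
      have h7 := hΨ a'
      omega
  refine ⟨n, Nat.one_le_iff_ne_zero.mpr (NeZero.ne n), le_rfl, fun a' => ?_⟩
  rw [hpot']
  constructor
  · intro hd
    by_contra hh
    have := hout a' hh
    omega
  · intro ha'
    have := hin a' ha'
    omega

end Tied

/-! ## §3 The choice toward the upper centre -/

/-- **The choice.**  At a type `r` of potential `≥ 2` there are a centre `a` realising the potential — equal to the upper index whenever `r` lies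
in an upper class — and two distinct deviation places `t ≠ t'` of `cst a ∖ r`. [folklore] -/
theorem exists_choice_up (r : CMF G c) (hr : 2 ≤ pot θ hθ hθc r) :
    ∃ a : ZMod (2 * n), ∃ t t' : G, pot θ hθ hθc r = ddist (cst θ hθ hθc a) r ∧ (∀ a'' : ZMod (2 * n), r ∈ upCl θ hθ hθc a'' → a = a'') ∧
      t ∈ (cst θ hθ hθc a).1 \ r.1 ∧ t' ∈ (cst θ hθ hθc a).1 \ r.1 ∧ t ≠ t' := by
  have hcentre : ∃ a : ZMod (2 * n), pot θ hθ hθc r = ddist (cst θ hθ hθc a) r ∧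
      ∀ a'' : ZMod (2 * n), r ∈ upCl θ hθ hθc a'' → a = a'' := by
    by_cases h : ∃ a'', r ∈ upCl θ hθ hθc a''
    · obtain ⟨a, ha⟩ := h
      exact ⟨a, pot_eq_of_up θ hθ hθc ha, fun a'' ha'' => up_unique θ hθ hθc ha ha''⟩
    · obtain ⟨a, ha⟩ := exists_pot_eq θ hθ hθc r
      exact ⟨a, ha, fun a'' ha'' => absurd ⟨a'', ha''⟩ h⟩
  obtain ⟨a, ha, huniq⟩ := hcentre
  have h2 : 1 < ((cst θ hθ hθc a).1 \ r.1).card := by rw [ha, ddist] at hr; omega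
  obtain ⟨t, ht, t', ht', htt'⟩ := Finset.one_lt_card.mp h2
  exact ⟨a, t, t', ha, huniq, ht, ht', htt'⟩

end

end Summit.HodgeConjecture.CorCM.Census.TwistGeneration
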